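/- Free-seat work of WIDTH SEAT 2/3 `ym-line-cbag-p1-w2` (prover-ym-line-cbag-p1-w2-g16-0), route `EguchiKawaiDirectionLadder`
(ideator ym-idea-2, LINE 8): with crux K_B `DirectionIncrement` PROVED in the tree (reduction of this seat + the off-diagonal-block
small-ball bound `HaarColumns.haar_offDiagBlockSq_smallBall` of seat w3) and the Assembly (p632126), the route's target — the
barrier-ledger fact `EguchiKawaiBreakdown` — hinges on the single crux K_A `TripleSmallBallMargin` (stmt-QuantumFields-27724).
Conditional corollary; nothing here bears on the Yang–Mills mass gap. -/
import Summits.QuantumFields.YangMills.Theorems.EguchiKawaiDirectionLadderAssembly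
import Summits.QuantumFields.YangMills.Theorems.EguchiKawaiDirectionLadderSingleLinkReduction
import Summits.QuantumFields.YangMills.Theorems.EguchiKawaiDirectionLadderHaarOffDiagSmallBall

/-!
# Route `EguchiKawaiDirectionLadder`: the barrier fact from K_A alone

`K_B = DirectionIncrement` is now a THEOREM of the tree: `directionIncrement_of_offDiagSmallBall` (this seat: Fubini step B2,
unitary diagonalisation + class-function property of the fibre measure, block choice from centre symmetry) applied to the
`N`-uniform Hilbert–Schmidt small-ball bound for off-diagonal blocks of a Haar unitary `HaarColumns.haar_offDiagBlockSq_smallBall`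
(seat w3).  Together with the Assembly (`assembly_proof`):

* `directionIncrement_unconditional : DirectionIncrement` (recorded here for the composition; the item stmt-QuantumFields-27725 is
  closed by seat w3's `--workitem` file, not by this one);
* `eguchiKawaiBreakdown_of_tripleSmallBallMargin : TripleSmallBallMargin → EguchiKawaiBreakdown` — the route's target, the
  BARRIER-LEDGER named fact (centre-symmetry breaking of the naive single-site Eguchi–Kawai model at weak coupling for every `d ≥ 3`),
  now hinges on the single open crux K_A (stmt-QuantumFields-27724: the `d = 3` centre-symmetric small-ball bound with some margin
  `e > 3/4`);
* `ekSymSmallBallBound_all_of_three` — concretely: a `d = 3` bound with margin propagates to every `d ≥ 3` with exponent `> d/4`.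

HONEST FRAMING.  Conditional on K_A (XL, open).  No summit statement, no mass gap, no continuum or reduction claim is proved here.
-/

set_option autoImplicit false

noncomputable section

open Literature.Barriers.QuantumFields

namespace Summit.QuantumFields.YangMills.Theorems.EguchiKawaiDirectionLadder

/-- **K_B is a theorem**: `DirectionIncrement` (one more reduced direction costs exponent `(1 − 2δ)/4`, uniformly in `N`), from the
landed reduction and the off-diagonal-block small-ball bound.  (Composition record; the item is closed by seat w3's file.) -/
theorem directionIncrement_unconditional :
    Summit.QuantumFields.YangMills.Theses.EguchiKawaiDirectionLadder.DirectionIncrement :=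
  directionIncrement_of_offDiagSmallBall HaarColumns.haar_offDiagBlockSq_smallBall

/-- **The route's target from K_A alone**: `TripleSmallBallMargin → EguchiKawaiBreakdown`. -/
theorem eguchiKawaiBreakdown_of_tripleSmallBallMargin
    (hA : Summit.QuantumFields.YangMills.Theses.EguchiKawaiDirectionLadder.TripleSmallBallMargin) :
    EguchiKawaiBreakdown :=
  assembly_proof hA directionIncrement_unconditional

/-- Concretely: a `d = 3` centre-symmetric small-ball bound with SOME margin `e₃ > 3/4` at some width `δ₀ > 0` yields, for every
`d ≥ 3`, a bound with exponent `> d/4` (the input of the tree's `EguchiKawaiBreakdown_of_smallBall`). -/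
theorem ekSymSmallBallBound_all_of_three {δ₀ e₃ C₃ : ℝ} (hδ₀ : 0 < δ₀) (he₃ : (3 : ℝ) / 4 < e₃)
    (h3 : EKSymSmallBallBound 3 δ₀ e₃ C₃) (d : ℕ) (hd : 3 ≤ d) :
    ∃ δ e C : ℝ, 0 < δ ∧ (d : ℝ) / 4 < e ∧ EKSymSmallBallBound d δ e C :=
  exists_ekSymSmallBallBound_gt_quarter ⟨δ₀, e₃, C₃, hδ₀, he₃, h3⟩ directionIncrement_unconditional d hd

end Summit.QuantumFields.YangMills.Theorems.EguchiKawaiDirectionLadder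

end
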